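import Literature.NumberTheory.EllipticCurves.Kato2004.EulerSystemDefinedValues
import HarnessLib

/-!
# Bloch–Kato 1990 §3 / Kato 1993 (LNM 1553) Ch. II §1.2 / Kato 2004 §9.4: the dual exponential map COMMUTES WITH
# CORESTRICTION in the cyclotomic `p`-tower — read on the tree's value datum `Λ` of `Kato2004.DefinedExpStarBody`
# as the existence of a TRACE-COHERENT ROOT SYSTEM (one predicate, one named fact)

Topic `NumberTheory/EllipticCurves`, sub-directory `Kato2004` (namespace = path).  Cell `bsd-cm`, seat `bsd-cm-k-ty1`
g40 (literature-prover), item [C-align] of director-bsd (993)(a)(iii) (re-typing docket after critic idea-crit-15 NOTE #66,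
memo `pub/ideators/idea-crit-15/K8-FRAME-DEFECT.md`; pen bsd-cm-plan D1211 CONCUR; host bsd-eis L129 criterion (iv)
FRAME COHERENCE).  ONE predicate (`IsTraceCoherentRootSystem`), ONE named PUBLISHED fact (`def … : Prop`, D-0014:
nothing asserted, no `_holds`; +1 declared debt); no other declaration; no `sorry`, no instance, no notation, no new
notion beyond the predicate.

## Why (the frame problem this file names; nothing of it is asserted)

`Kato2004.DefinedExpStarBody W p f d ι κK Λ` ((RES)/(DEF) of `EulerSystemDefinedValues`) pins the value map
`Λ k r : H¹(ℚ(μ_m), T_pW) → ℚ_p ⊗ ℚ(ζ_m)` (`m = cycLevel p k r`) to the semi-local dual exponential of Bloch–Kato,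
read at ONE completion and transported into the ABSTRACT level field `CyclotomicField m ℚ` along the identification of
`ℚ(μ_m) ⊂ ℚ̄` with `CyclotomicField m ℚ` that the tower embedding `absGaloisRestrictTower ℚ ℚ_v (ℚ(ζ_m))_{w₀}`
(`Literature.absClosureEmbedding`, one opaque choice per level) induces.  A root of unity of the abstract field —
e.g. Lean's `IsCyclotomicExtension.zeta m ℚ (CyclotomicField m ℚ)` — has NO position relative to that frame which
is coherent from one `p`-power level to the next; statements that multiply a `Λ`-value read-off by a Gauss sum taken
at such a root are frame-mismatched (critic NOTE #66 on `Kobayashi2003.ColPlusInterpolation`).  The cure is to NAME a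
root system `μ = (μ_n ∈ ℚ(ζ_{p^{n+1}}))_n` and to TIE IT TO `Λ` by the one cross-level property of `exp*` that print
provides: compatibility with corestriction (`H¹(ℚ(μ_{p^{n+2}}), T) → H¹(ℚ(μ_{p^{n+1}}), T)`) and trace
(`ℚ(ζ_{p^{n+2}}) → ℚ(ζ_{p^{n+1}})`), the trace being taken along THE field map `j_n` with `j_n(μ_n) = μ_{n+1}^p`.
If `μ_n` corresponds to `ρ_n ∈ ℚ̄` under the level-`n` frame, the trace clause holds exactly when `j_n` is the
frame-induced inclusion, i.e. when `ρ_{n+1}^p = ρ_n` (as soon as the `exp*`-values at that level are not all fixed by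
a non-trivial element of `Gal(ℚ(ζ_{p^{n+1}})/ℚ)`); so a trace-coherent `μ` IS a norm-coherent root system seen
through the frames of `Λ`, and conversely every norm-coherent `(ρ_n)` of `ℚ̄` gives one (the named fact below).

## The print (each ≤ 3 lines; locators)

* [BlochKato1990, §3, Def. 3.10 and Prop. 3.8 (pp. 354–356)]: `exp*` is the transpose of the exponential map
  `exp : D_dR(V)/D⁰_dR ⊗ K → H¹(K, V)` under local Tate duality; `exp` is functorial in the `p`-adic field `K`
  (it is the connecting map of the fundamental exact sequence `0 → ℚ_p → B_crys^{φ=1} ⊕ B⁺_dR → B_dR → 0` tensored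
  with `V`), and restriction `H¹(K, V) → H¹(K′, V)` is dual to corestriction; hence `exp*_K ∘ cor_{K′/K} =
  Tr_{K′/K} ∘ exp*_{K′}`.
* [Kurihara2002, §3, Invent. Math. 149 p. 207 (store `paper:url-3e548eeedfb3` p0013)]: «`exp* : H¹(ℚ_p(μ_{p^n}), V) → D ⊗ ℚ_p(μ_{p^n})`,
  which is defined by Tate duality as the dual of the exponential map (cf. [13] Chap. II §1.2)»; Lemma 3.2
  `P_n(x, z) = Σ_{σ∈G_n} Tr_{ℚ_p(μ_{p^n})/ℚ_p}[γ_n(x)^σ, exp*(z)]σ`; **Lemma 3.3** «Let `π : ℚ_p[G_n] → ℚ_p[G_{n−1}]` be the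
  natural map. Then `π(P_n(x, z)) = P_{n−1}(x, N(z))` where `N : H¹(ℚ_p(μ_{p^n}), V) → H¹(ℚ_p(μ_{p^{n−1}}), V)` is the
  corestriction map» — the trace/corestriction compatibility of `exp*` for `V = V_pE` in the cyclotomic tower (cf. Rubin
  [25] Prop. A2).  [Angurel2025, Prop. 4.3.2, arXiv:2504.20759 p. 23 (store `paper:arxiv-2504.20759` p0023 L10–12)]:
  «Let `c ∈ H¹(F, V ⊗ O_d(χ))` and `d = cor_{KF/F} c`. Then `exp*_{ω_E,χ̄}(d) = N_{KF/F} exp*_{ω_E,χ̄}(c)`», proof by the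
  [NSW] res/cor duality square.
* [Kato1993LNM1553, Ch. II §1.2 (the dual exponential map `exp*` and its functoriality)]; [Kato2004Asterisque, §9.4
  (p. 188): «we have the dual exponential map `exp* : H¹(ℚ(ζ_m) ⊗ ℚ_p, V) → S(f) ⊗ F_λ ⊗ ℚ(ζ_m)`», applied
  compatibly in the tower `m ∈ Ξ` (Prop. 8.12 (p. 186), Thm. 12.5 (p. 221): norm-compatible zeta elements have
  trace-compatible `exp*`-values)]; [Rubin2000, App. B §2 (continuous cohomology, restriction/corestriction)].
* The Galois-sum form of the relative trace used below (`Tr_{L′/L}(x) = Σ_{g ∈ Gal(L′/L)} g x` inside `L′`, and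
  `Gal(ℚ(ζ_{p^{n+2}})/ℚ(ζ_{p^{n+1}})) = {σ_c : c ≡ 1 (mod p^{n+1})}`) is [folklore].

WHAT THIS IS NOT: not the compatibility of `exp*` with RESTRICTION (true as well, not needed); nothing at the tame
levels `r ≠ ∅` (the consumer — Kobayashi's interpolation law `Kobayashi2003.ColPlusInterpolationCoherent` — reads the
pure `p`-power levels `(n+1, ∅)` only; TODO(general form): all `(k, r)`); not a second axiom on Kato's fact
`exists_eulerSystem_definedExpStar_values` (rider R-ι of `EulerSystemValues` stands: director (993)(a)(iii) ruled this
a SEPARATE named fact); nothing about BSD; no summit statement touched; 19223 OPEN.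
CHEAPEST FALSIFIER (registered, not run — kit 0): none numeric; the statement is structural.  A typing falsifier: the
predicate must be satisfiable TOGETHER with `DefinedExpStarBody` by the SAME `Λ` — the consumer F1′ instantiates both.

## References
* [BlochKato1990] S. Bloch, K. Kato, *L-functions and Tamagawa numbers of motives*, Grothendieck Festschrift I (1990),
  §3 (Def. 3.10, Prop. 3.8).
* [Kato1993LNM1553] K. Kato, *Lectures on the approach to Iwasawa theory for Hasse–Weil L-functions via B_dR*,
  LNM 1553 (1993), Ch. II §1.2.
* [Kurihara2002] M. Kurihara, *On the Tate Shafarevich groups over cyclotomic fields of an elliptic curve with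
  supersingular reduction I*, Invent. Math. 149 (2002) 195–224, §3 Lemma 3.2–3.3 (p. 207).
* [Angurel2025] A. Angurel, *Kolyvagin systems of rank 0 …*, arXiv:2504.20759, Prop. 4.3.2 (p. 23).
* [Kato2004Asterisque] K. Kato, Astérisque 295 (2004), §9.4 (p. 188), Prop. 8.12 (p. 186), Thm. 12.5 (p. 221).
* [Rubin2000] K. Rubin, *Euler Systems*, App. B §2.
* Tree: `Kato2004/EulerSystemDefinedValues.lean` ((RES)/(DEF), `DefinedExpStarBody`), `Kato2004/EulerSystemValues.lean`
  (`cycLevel`, `cycSubgroup`, `sigma`), `GaloisRepresentations/EulerSystem.lean` (`EulerSystemLevels.coresP`).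
-/

noncomputable section

open scoped Classical TensorProduct NumberField BigOperators
open Polynomial Field IsDedekindDomain NumberField CongruenceSubgroup
open Literature.NumberTheory.GaloisRepresentations
open Literature.NumberTheory.EllipticCurves

namespace Literature.NumberTheory.EllipticCurves.Kato2004

open EulerSystemValues Rat.HeightOneSpectrum

/-! ## §1 The predicate: a root system TRACE-COHERENT with a value datum `Λ` -/

section Predicate

variable (W : WeierstrassCurve ℚ) [W.IsElliptic] (p : ℕ) [Fact p.Prime]
  [ContinuousSMul ℤ_[p] (W.tateModule p)] [Module.Free ℤ_[p] (W.tateModule p)]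
  [Module.Finite ℤ_[p] (W.tateModule p)]

/-- **`IsTraceCoherentRootSystem W p Λ μ` — a primitive root system `μ = (μ_n ∈ ℚ(ζ_{p^{n+1}}))_{n ≥ 0}` on the
pure `p`-power levels `(n+1, ∅)` that is TRACE-COHERENT with the value maps `Λ`:** (1) `μ_n` is a primitive
`p^{n+1}`-th root of unity of `CyclotomicField (cycLevel p (n+1) ∅) ℚ`; (2) for every `n`, every
`ℚ`-algebra map `j : ℚ(ζ_{p^{n+1}}) → ℚ(ζ_{p^{n+2}})` with `j(μ_n) = μ_{n+1}^p` (there is exactly one: `μ_{n+1}^p` is a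
primitive `p^{n+1}`-th root and `μ_n` generates — Mathlib `IsPrimitiveRoot.embeddingsEquivPrimitiveRoots`,
`IsPrimitiveRoot.powerBasis`/`PowerBasis.algHom_ext`; `m(n+1,∅) = p^{n+1}·1`) and every class `y ∈ H¹(ℚ(μ_{p^{n+2}}), T_pW)`:
`Σ_{c ∈ (ℤ/p^{n+2})ˣ, c ≡ 1 (p^{n+1})} (1 ⊗ σ_c)(Λ_{n+2,∅} y) = (1 ⊗ j)(Λ_{n+1,∅}(cor y))` — «`exp*` commutes with
corestriction/trace», the trace `ℚ(ζ_{p^{n+2}}) → ℚ(ζ_{p^{n+1}})` being written as the Galois sum over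
`Gal(ℚ(ζ_{p^{n+2}})/j ℚ(ζ_{p^{n+1}}))` followed by `j` (`σ_c = EulerSystemValues.sigma`, `cor = EulerSystemLevels.coresP`
of `cyclotomicLevelsRat p ∅`, whose levels ARE `cycSubgroup`, `cycSubgroup_eq_level`).  A predicate; nothing asserted.
[cite: BlochKato1990, §3 Def. 3.10 and Prop. 3.8] [cite: Kato1993LNM1553, Ch. II §1.2]
[cite: Kurihara2002, §3 Lemma 3.2 and Lemma 3.3 (Invent. Math. 149, p. 207)] [cite: Angurel2025, Prop. 4.3.2 (arXiv:2504.20759, p. 23)]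
[cite: Kato2004Asterisque, §9.4 (p. 188) and Prop. 8.12 (p. 186)] -/
def IsTraceCoherentRootSystem
    (Λ : ∀ (k : ℕ) (r : Finset (HeightOneSpectrum (𝓞 ℚ))),
      H1 (tateRep W p) (cycSubgroup p k r) →ₗ[ℤ_[p]] ℚ_[p] ⊗[ℚ] CyclotomicField (cycLevel p k r) ℚ)
    (μ : ∀ n : ℕ, CyclotomicField (cycLevel p (n + 1) ∅) ℚ) : Prop :=
  (∀ n : ℕ, IsPrimitiveRoot (μ n) (p ^ (n + 1))) ∧
  ∀ (n : ℕ) (j : CyclotomicField (cycLevel p (n + 1) ∅) ℚ →ₐ[ℚ] CyclotomicField (cycLevel p (n + 2) ∅) ℚ),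
    j (μ n) = μ (n + 1) ^ p →
    ∀ y : H1 (tateRep W p) (cycSubgroup p (n + 2) ∅),
      (∑ c ∈ (Finset.univ.filter fun c : (ZMod (cycLevel p (n + 2) ∅))ˣ =>
          ZMod.unitsMap (show cycLevel p (n + 1) ∅ ∣ cycLevel p (n + 2) ∅ from
            mul_dvd_mul_right (pow_dvd_pow p (Nat.le_succ (n + 1))) _) c = 1),
        Algebra.TensorProduct.map (AlgHom.id ℚ ℚ_[p])
          (sigma (cycLevel p (n + 2) ∅) c :
            CyclotomicField (cycLevel p (n + 2) ∅) ℚ →ₐ[ℚ] CyclotomicField (cycLevel p (n + 2) ∅) ℚ)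
          (Λ (n + 2) ∅ y)) =
      Algebra.TensorProduct.map (AlgHom.id ℚ ℚ_[p]) j
        (Λ (n + 1) ∅ ((cyclotomicLevelsRat p (∅ : Set (HeightOneSpectrum (𝓞 ℚ)))).coresP (tateRep W p)
          (Nat.le_succ (n + 1)) ∅ y))

end Predicate

/-! ## §2 The named fact [C-align]: the (DEF)-pinned `Λ` admits a trace-coherent root system -/

section Fact

/-- **Bloch–Kato 1990 §3 / Kato 1993 II §1.2 / Kato 2004 §9.4 — `exp*` COMMUTES WITH CORESTRICTION in the cyclotomic
`p`-tower, read on the (RES)/(DEF)-pinned value datum: for every `(W, p, f, d, ι, κK, Λ)` with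
`Kato2004.DefinedExpStarBody W p f d ι κK Λ` there is a root system `μ = (μ_n)_n`, `μ_n` a primitive `p^{n+1}`-th root
of unity of `ℚ(ζ_{p^{n+1}})`, that is TRACE-COHERENT with `Λ` (`IsTraceCoherentRootSystem W p Λ μ`):
`Σ_{c ≡ 1 (p^{n+1})} (1⊗σ_c)(Λ_{n+2,∅} y) = (1⊗j_n)(Λ_{n+1,∅}(cor y))`, `j_n(μ_n) = μ_{n+1}^p`.**  CONTENT (module
docstring): (DEF) makes `Λ_{k,∅}` the canonical semi-local `exp*` at the unique place over `p`, transported into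
`CyclotomicField (p^k) ℚ` along the frame of the tree's tower embedding at that level; take `ρ = (ρ_n)` ANY
norm-coherent system of primitive `p^{n+1}`-th roots of unity in `ℚ̄` and `μ_n :=` the image of `ρ_n` in that frame —
then `j_n` is the frame-induced inclusion and the clause is `exp* ∘ cor = Tr ∘ exp*` [BK90 §3; Kato LNM 1553 II §1.2;
Kato 2004 §9.4 with Prop. 8.12].  Stated for the pure `p`-power levels (`r = ∅`), all that the consumer reads.
Named fact (D-0014); nothing asserted; no `_holds` expected (the tree has functoriality of `dualExp` in the
representation only, `PAdicHodge/BlochKatoDualExponential.lean`; no corestriction on `PeriodRingData.dualExpCoord`).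
Non-vacuity of the antecedent: `Kato2004.exists_eulerSystem_definedExpStar_values` (print).
[cite: Kurihara2002, §3 Lemma 3.3 with Lemma 3.2 (Invent. Math. 149, p. 207)] [cite: Angurel2025, Prop. 4.3.2 (arXiv:2504.20759, p. 23)]
[cite: BlochKato1990, §3 Def. 3.10 and Prop. 3.8] [cite: Kato1993LNM1553, Ch. II §1.2]
[cite: Kato2004Asterisque, §9.4 (p. 188), Prop. 8.12 (p. 186), Thm. 12.5 (p. 221)] [cite: Rubin2000, App. B §2] -/
def exists_traceCoherentRootSystem_of_definedExpStarBody : Prop :=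
  ∀ (W : WeierstrassCurve ℚ) [W.IsElliptic] (p : ℕ) [Fact p.Prime]
    [ContinuousSMul ℤ_[p] (W.tateModule p)] [Module.Free ℤ_[p] (W.tateModule p)]
    [Module.Finite ℤ_[p] (W.tateModule p)]
    {N : ℕ} [NeZero N] (f : CuspForm (Gamma0 N) 2) (d : _) (ι : (m : ℕ) → (CyclotomicField m ℚ →+* ℂ))
    (κK : ℝ)
    (Λ : ∀ (k : ℕ) (r : Finset (HeightOneSpectrum (𝓞 ℚ))),
      H1 (tateRep W p) (cycSubgroup p k r) →ₗ[ℤ_[p]] ℚ_[p] ⊗[ℚ] CyclotomicField (cycLevel p k r) ℚ),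
    DefinedExpStarBody W p f d ι κK Λ →
    ∃ μ : ∀ n : ℕ, CyclotomicField (cycLevel p (n + 1) ∅) ℚ, IsTraceCoherentRootSystem W p Λ μ

end Fact

end Literature.NumberTheory.EllipticCurves.Kato2004

end
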